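import Summits.HodgeConjecture.HodgeConjecture.Theorems.R90S10ArchTransferSignsOfArchKit   -- ★ S10 kit: `archDeltaPP`, `IsArchEndoCharId`, `ArchCompatibleFamiliesH`, (W)(C) tokens
import Summits.HodgeConjecture.HodgeConjecture.Theorems.R90S2TensorRepLetterDefs          -- ★ p864621 ℓ3: `HasLocalComponents` (+ ★ `archTensor`, `CuspH₀`)
import Summits.HodgeConjecture.HodgeConjecture.Theorems.R90S2ArchBlockPacketLetterDefs     -- ★ p864938 ℓ1′: `BlockPacketData` (full local packet `Fin 3`, signs `sgn`, members `bpos bneg`)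
import Summits.HodgeConjecture.HodgeConjecture.Theorems.R90S2ArchStablyNullOfLocal         -- ★ CARD 11 (LH4-p05): `IsArchLocStablyNull` (LOCAL stable nullity at one place)
import HarnessLib

/-!
# R90-TF ∕ S2 «Ch. 12 archimedean block» — `R90S2ArchBlockPacketEndoscopyLetterLocDefs`: LETTERS-DEFS part ℓT2-E (v3, LOCAL (E2)) — the global-archimedean
# ENDOSCOPY LETTER `ArchBlockPacketEndoscopyLetterLoc L μ S` for tensor families of members of the full block packets, with clause (E2) in print's LOCAL shape

Cell `pub/hodgecm-mathlib`, Track B ∕ R90-TF, section S2, crux h413 = `stmt-HodgeConjecture-24833`, route `HCCMUnconditional`.  Typed by R90-C11-typ2 (g4) on S2 desk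
K2E1b-plan (g9)'s RULING R-S2-D4 2026-09-05T03:41:55Z (junction finding J-D4-RI of this seat, verified by R90-C11-audit1 (g2) 03:40:36Z): clause (E2) of print
(p. 218 L18–21: «`f_u = f_{1u} − f_{2u}` has vanishing stable orbital integrals») is a LOCAL statement on `U(σ_u Φ₃)(ℂ)`; ★ CARD 11 `IsArchLocStablyNull` states it
locally and ★ CARD 11 §3 `isArchStablyNull_archTensor_update_of_isArchLocStablyNull` turns it into the GLOBAL (E2) of ★ v2 `ArchBlockPacketEndoscopyLetter`
(`R90S2ArchBlockPacketEndoscopyLetterDefs`) — for local Haar measures `νw` that are RIGHT-INVARIANT.  This file is ★ v2's text VERBATIM with EXACTLY the ruling's three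
deltas: (i) the `νw` binder group gains `[∀ w, (νw w).IsMulRightInvariant]` (print's local Haar measures are bi-invariant; the binder is what ★ CARD 11's `def`
needs to be stated, and the bridge CARD 12 `archBlockPacketEndoscopyLetter_of_loc` DISCHARGES it from v2's global frame through CARD 6♯
`isMulRightInvariant_of_map_archPiEquivCM_eq_pi` — audit R3: the added binder strengthens the frame hypotheses of the letter, nothing is smuggled into T2);
(ii) the Borel `letI ∕ haveI` chain on the LOCAL centraliser quotients `U(σ_w Φ₃)(ℂ) ⧸ Z(δ)` (★ CARD 11 §1's instance binders; as v2 does for `G_∞`, `H_∞`);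
(iii) (E2) := `IsArchLocStablyNull L u (νw u) ⇑((d u).φ (d u).bpos - (d u).φ (d u).bneg)`.  (E1) and (E3) bytes are v2's.

WHAT IS DEFINED (ONE closed-shape parametrised `Prop` + `Iff.rfl`; NO socket, NO instance, NO notation, NO `sorry`; nothing asserted).
`ArchBlockPacketEndoscopyLetterLoc L μ S` — in T2's frame VERBATIM (`R90.S2.stub_R90_S2_archBlockPacketCusp`, D ED. 2 :90–:126: right-invariant Haar `ν, νH` on
`G_∞ = U(Φ₃)(L ⊗ ℝ)`, `H_∞`; Borel `letI`s on the orbit quotients; families `mH, mG`, centraliser Haar families `tH, t`; (W) `mG.IsQuotientOf (IsRegularElt ·) ν t`; (C) the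
★ `archStableCentralizerEquiv` transport of `t`; ★ `ArchCompatibleFamiliesH`; ★ `IsArchNondegenerate`; ★ `IsArchDeltaTransferExists`), for EVERY family of RIGHT-INVARIANT
local Haar measures `νw` matching `ν` along ★ `archPiEquivCM`: THERE IS full-packet data `d w : BlockPacketData (Fin 3) (U(σ_w Φ₃)(ℂ)) (νw w) (S w)` at every complex
place `w` (three inequivalent irreducible unitary square-integrable members, dual pseudo-coefficients, signs `sgn` with `sgn bpos = 1`, `sgn bneg = −1`; print
p. 218 L11–20) such that
* (E1) every tensor family `ϖ k`, `k : places → Fin 3`, with local components `(d w).π (k w)` (★ ℓ3 `HasLocalComponents`) satisfies the archimedean endoscopic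
  character identity ★ `IsArchEndoCharId` with signs `s k = ∏_w (d w).sgn (k w)` and SOME unitary `ρ_∞` of `H_∞` (Prop. 12.3.2 ⊗ places, all three members);
* (E2) for every place `u`, the LOCAL difference `φ_u^{bpos} − φ_u^{bneg}` is ★ `IsArchLocStablyNull` on `U(σ_u Φ₃)(ℂ)` for `νw u` (p. 218 L18–21, print's shape);
* (E3) for every place `u`, the one-place difference tensor `⊗_{w ≠ u} φ_w^{bpos} ⊗ (φ_u^{bpos} − φ_u^{bneg})` has an ★ `ArchSmooth₂` `Δ″_∞`-transfer `fH`
  (★ `IsArchDeltaTransfer`) that is ★ `CuspH₀` at every `ι` (p. 218 L22–25).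
A LETTER: the hypothesis shape of the LOCAL LETTER SOCKET of D ED. 4 (`letter_R90_S2_blockPacketEndoscopyLoc`); the bridge CARD 12 gives ★ v2 from it, so the assembly
★ CARD 8 `archBlockPacketCusp_of_letters` is untouched; payment = CLOSURE-row archimedean representation theory — not attempted in S2 this rung.

HONEST LABEL: a parametrised `Prop` asserts nothing and pays nothing; HC_CM is proved only modulo the 7 printed citations (2 remaining named inputs: hLiu418 =
stmt-HodgeConjecture-24832, h413 = stmt-HodgeConjecture-24833) until rung 0 closes.  Count-neutral (`--supports stmt-HodgeConjecture-24833`).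

References (print): Rogawski 1990 §13.8 p. 218 L11–25, §12.3 Prop. 12.3.2 ∕ 12.3.3 p. 178, §4.1 (4.1.1) p. 39, §4.3 (4.3.1) p. 43; Shelstad 1979 Lemma 5.3, §4 p. 20;
Arthur 1988 (Invariant trace formula II) §7 p. 538; Clozel–Delorme 1984 Thm. 1.
-/

set_option autoImplicit false
set_option linter.dupNamespace false

noncomputable section

open NumberField NumberField.InfinitePlace MeasureTheory CompactlySupported
open scoped Matrix MatrixGroups InnerProductSpace

namespace Summit.HodgeConjecture.HodgeConjecture.R90.S2

open Literature.NumberTheory.Automorphic Literature.NumberTheory.Automorphic.UnitaryGroup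
open Literature.NumberTheory.Rogawski1990
open Literature.NumberTheory.GaloisRepresentations (HeckeCharacter)
open Summit.HodgeConjecture.HodgeConjecture.Cruxes.H413.K2E1bGKCohomologyU21.U8 (HasArchOpTrace)
open Summit.HodgeConjecture.HodgeConjecture.R90.S10 (GInf HInf phi3 archDeltaPP IsArchEndoCharId IsArchStablyNull)

/-! ## §1 «ℓT2-E» (v3, LOCAL (E2)) — the global-archimedean ENDOSCOPY LETTER for tensor families of full local packets, (E2) in print's local shape -/

section Letter

variable (L : Type) [Field L] [NumberField L] [IsCMField L]

open scoped Classical in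
/-- **«ℓT2-E» (v3, full packets, LOCAL (E2)) — the global-archimedean ENDOSCOPY LETTER** for tensor families of members of the full local packets, in T2's
frame VERBATIM (measures `ν, νH`, families `mH, mG, tH, t`, (W), (C), ★ `ArchCompatibleFamiliesH`, non-degeneracy, transfer existence): for every family of
RIGHT-INVARIANT local Haar measures `νw` matching `ν` along ★ `archPiEquivCM` there is full-packet data `d w` (★ ℓ1′ `BlockPacketData (Fin 3)`: three members, dual
pseudo-coefficients, signs) at every complex place with (E1) the endoscopic character identity ★ `IsArchEndoCharId` for EVERY tensor family of members
`k : places → Fin 3` (signs `∏_w (d w).sgn (k w)`, some unitary `ρ_∞` of `H_∞`), (E2) LOCAL stable nullity ★ `IsArchLocStablyNull` of the difference of the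
pseudo-coefficients of the two signed members `bpos ∕ bneg` at the place `u` (print's shape, p. 218 L18–21), and (E3) an ★ `ArchSmooth₂` `Δ″_∞`-transfer of the
one-place difference tensor that is ★ `CuspH₀` at every `ι`.  Delta to ★ v2 `ArchBlockPacketEndoscopyLetter`: the binder `[∀ w, (νw w).IsMulRightInvariant]`, the
Borel structures on the local centraliser quotients, and (E2) local — the bridge `archBlockPacketEndoscopyLetter_of_loc` (CARD 12) recovers v2.  A closed-shape
parametrised `Prop` (binders `μ`, `S`): nothing is asserted; its payment is CLOSURE-row archimedean representation theory (print: Rogawski 1990 §13.8 p. 218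
L11–25 and Prop. 12.3.2 ∕ 12.3.3 p. 178; Shelstad 1979 Lemma 5.3, §4; Arthur 1988 §7 p. 538; Clozel–Delorme 1984) — the citation tokens ride on
`archBlockPacketEndoscopyLetterLoc_iff`. -/
def ArchBlockPacketEndoscopyLetterLoc (μ : HeckeCharacter L)
    (S : ∀ w : {w : InfinitePlace L // w.IsComplex}, C_c(↥(archLocal L 3 (phi3 L) w), ℂ) → Prop) : Prop :=
  ∀ [MeasurableSpace (GInf L)] [BorelSpace (GInf L)] (ν : Measure (GInf L)) [ν.IsHaarMeasure] [ν.IsMulRightInvariant]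
    [MeasurableSpace (HInf L)] [BorelSpace (HInf L)] (νH : Measure (HInf L)) [νH.IsHaarMeasure] [νH.IsMulRightInvariant],
  letI : ∀ a : HInf L, MeasurableSpace (HInf L ⧸ Subgroup.centralizer ({a} : Set (HInf L))) := fun _ => borel _
  haveI : ∀ a : HInf L, BorelSpace (HInf L ⧸ Subgroup.centralizer ({a} : Set (HInf L))) := fun _ => ⟨rfl⟩
  letI : ∀ γ : GInf L, MeasurableSpace (GInf L ⧸ Subgroup.centralizer ({γ} : Set (GInf L))) := fun _ => borel _
  haveI : ∀ γ : GInf L, BorelSpace (GInf L ⧸ Subgroup.centralizer ({γ} : Set (GInf L))) := fun _ => ⟨rfl⟩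
  ∀ (mH : OrbitalMeasureFamily (HInf L)) (mG : OrbitalMeasureFamily (GInf L))
    (tH : ∀ a : HInf L, Measure (Subgroup.centralizer ({a} : Set (HInf L))))
    (t : ∀ γ : GInf L, Measure (Subgroup.centralizer ({γ} : Set (GInf L)))),
    mG.IsQuotientOf (fun γ => IsRegularElt (γ.val : GL (Fin 3) (mixedEmbedding.mixedSpace L))) ν t →
    (∀ (γ₁ γ₂ : GInf L)
        (h₁ : IsRegularElt (γ₁.val : GL (Fin 3) (mixedEmbedding.mixedSpace L)))
        (hc : Corresponds (UnitaryGroup.conjMixed (↥(maximalRealSubfield L)) L (IsCMField.complexConj L))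
          (UnitaryGroup.archFormOf L 3 (phi3 L)) (UnitaryGroup.archFormOf L 3 (phi3 L)) γ₁ γ₂),
        Measure.map ⇑(UnitaryGroup.archStableCentralizerEquiv L (UnitaryGroup.isUnit_antidiagOne_det L 3).ne_zero
          (UnitaryGroup.isUnit_antidiagOne_det L 3).ne_zero hc h₁) (t γ₁) = t γ₂) →
    ArchCompatibleFamiliesH L νH mH tH t →
    IsArchNondegenerate L (phi3 L) (archDeltaPP L μ) →
    IsArchDeltaTransferExists L (phi3 L) (archDeltaPP L μ) mH mG (ArchSmooth L 3 (phi3 L)) (ArchSmooth₂ L) →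
    ∀ [∀ w : {w : InfinitePlace L // w.IsComplex}, MeasurableSpace ↥(archLocal L 3 (phi3 L) w)]
      [∀ w : {w : InfinitePlace L // w.IsComplex}, BorelSpace ↥(archLocal L 3 (phi3 L) w)]
      (νw : ∀ w : {w : InfinitePlace L // w.IsComplex}, Measure ↥(archLocal L 3 (phi3 L) w))
      [∀ w, (νw w).IsHaarMeasure] [∀ w, (νw w).IsMulRightInvariant],
    letI : ∀ (w : {w : InfinitePlace L // w.IsComplex}) (δ : ↥(archLocal L 3 (phi3 L) w)),
        MeasurableSpace (↥(archLocal L 3 (phi3 L) w) ⧸ Subgroup.centralizer ({δ} : Set ↥(archLocal L 3 (phi3 L) w))) := fun _ _ => borel _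
    haveI : ∀ (w : {w : InfinitePlace L // w.IsComplex}) (δ : ↥(archLocal L 3 (phi3 L) w)),
        BorelSpace (↥(archLocal L 3 (phi3 L) w) ⧸ Subgroup.centralizer ({δ} : Set ↥(archLocal L 3 (phi3 L) w))) := fun _ _ => ⟨rfl⟩
    ν.map ⇑(archPiEquivCM L (phi3 L) (N := 3)) = Measure.pi νw →
      ∃ d : ∀ w : {w : InfinitePlace L // w.IsComplex}, BlockPacketData (Fin 3) ↥(archLocal L 3 (phi3 L) w) (νw w) (S w),
        -- (E1) endoscopic character identity for every tensor family of members
        (∀ (EG : ({w : InfinitePlace L // w.IsComplex} → Fin 3) → Type)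
            [∀ k, NormedAddCommGroup (EG k)] [∀ k, InnerProductSpace ℂ (EG k)] [∀ k, CompleteSpace (EG k)]
            (ϖ : ∀ k, ContRepresentation ℂ (GInf L) (EG k)) (hu : ∀ k, (ϖ k).IsUnitary) (hsc : ∀ k, (ϖ k).IsStronglyContinuous),
            (∀ k, letI := fun w => (d w).instNACG (k w); letI := fun w => (d w).instIPS (k w); letI := fun w => (d w).instCS (k w)
              HasLocalComponents (archPiEquivCM L (phi3 L) (N := 3)) ν νw (ϖ k) (hu k) (hsc k)
                (fun w => (d w).E (k w)) (fun w => (d w).π (k w)) (fun w => (d w).hu (k w)) (fun w => (d w).hsc (k w))) →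
            ∃ (EH : Type) (_ : NormedAddCommGroup EH) (_ : InnerProductSpace ℂ EH) (_ : CompleteSpace EH)
              (ρ : ContRepresentation ℂ (HInf L) EH) (huH : ρ.IsUnitary) (hscH : ρ.IsStronglyContinuous),
              IsArchEndoCharId L (archDeltaPP L μ) mH mG ν νH EG ϖ hu hsc (fun k => ∏ w, (d w).sgn (k w)) ρ huH hscH) ∧
        -- (E2) LOCAL + (E3) per place `u`: the local difference is locally stably null; the one-place difference tensor has a cuspidal smooth transfer
        (∀ u : {w : InfinitePlace L // w.IsComplex},
          IsArchLocStablyNull L u (νw u) ⇑((d u).φ (d u).bpos - (d u).φ (d u).bneg) ∧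
            ∃ fH : C_c(HInf L, ℂ), ArchSmooth₂ L ⇑fH ∧
              IsArchDeltaTransfer L (phi3 L) (archDeltaPP L μ) mH mG ⇑fH
                ⇑(archTensor L (phi3 L) (Function.update (fun w => (d w).φ (d w).bpos) u ((d u).φ (d u).bpos - (d u).φ (d u).bneg))) ∧
              ∀ ι : L →+* ℂ, CuspH₀ L mH ι ⇑fH)

open scoped Classical in
/-- Unfolding of `ArchBlockPacketEndoscopyLetterLoc` (definitional): the global-archimedean endoscopy letter for tensor families of members of the FULL local packets
`Π(ρ_w) = {π_{1w}, π_{2w}, π_{3w}}`, in T2's frame with RIGHT-INVARIANT local Haar measures — (E1) the endoscopic character identity of Prop. 12.3.2 tensored over the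
complex places with the signs `⟨ρ_v, π_{jv}⟩ ∈ {±1}` of the chosen integrable `ρ` («not all equal»), (E2) LOCAL stable nullity of the difference of the
pseudo-coefficients of the two signed members at one place («`f_u = f_{1u} − f_{2u}` has vanishing stable orbital integrals», Shelstad's characterisation),
(E3) the smooth cuspidal `Δ″_∞`-transfer of the one-place difference tensor («`f^H` a linear combination of pseudo-coefficients on `H`»).
[cite: Rogawski1990, §13.8 p. 218 L11–25; §12.3 Prop. 12.3.2 p. 178; §4.3 (4.3.1) p. 43] [cite: Shelstad1979, L. 5.3] [cite: Arthur1988InvariantTraceFormulaII, §7 p. 538]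
[cite: ClozelDelorme1984] -/
theorem archBlockPacketEndoscopyLetterLoc_iff (μ : HeckeCharacter L)
    (S : ∀ w : {w : InfinitePlace L // w.IsComplex}, C_c(↥(archLocal L 3 (phi3 L) w), ℂ) → Prop) :
    ArchBlockPacketEndoscopyLetterLoc L μ S ↔
      ∀ [MeasurableSpace (GInf L)] [BorelSpace (GInf L)] (ν : Measure (GInf L)) [ν.IsHaarMeasure] [ν.IsMulRightInvariant]
        [MeasurableSpace (HInf L)] [BorelSpace (HInf L)] (νH : Measure (HInf L)) [νH.IsHaarMeasure] [νH.IsMulRightInvariant],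
      letI : ∀ a : HInf L, MeasurableSpace (HInf L ⧸ Subgroup.centralizer ({a} : Set (HInf L))) := fun _ => borel _
      haveI : ∀ a : HInf L, BorelSpace (HInf L ⧸ Subgroup.centralizer ({a} : Set (HInf L))) := fun _ => ⟨rfl⟩
      letI : ∀ γ : GInf L, MeasurableSpace (GInf L ⧸ Subgroup.centralizer ({γ} : Set (GInf L))) := fun _ => borel _
      haveI : ∀ γ : GInf L, BorelSpace (GInf L ⧸ Subgroup.centralizer ({γ} : Set (GInf L))) := fun _ => ⟨rfl⟩
      ∀ (mH : OrbitalMeasureFamily (HInf L)) (mG : OrbitalMeasureFamily (GInf L))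
        (tH : ∀ a : HInf L, Measure (Subgroup.centralizer ({a} : Set (HInf L))))
        (t : ∀ γ : GInf L, Measure (Subgroup.centralizer ({γ} : Set (GInf L)))),
        mG.IsQuotientOf (fun γ => IsRegularElt (γ.val : GL (Fin 3) (mixedEmbedding.mixedSpace L))) ν t →
        (∀ (γ₁ γ₂ : GInf L)
            (h₁ : IsRegularElt (γ₁.val : GL (Fin 3) (mixedEmbedding.mixedSpace L)))
            (hc : Corresponds (UnitaryGroup.conjMixed (↥(maximalRealSubfield L)) L (IsCMField.complexConj L))
              (UnitaryGroup.archFormOf L 3 (phi3 L)) (UnitaryGroup.archFormOf L 3 (phi3 L)) γ₁ γ₂),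
            Measure.map ⇑(UnitaryGroup.archStableCentralizerEquiv L (UnitaryGroup.isUnit_antidiagOne_det L 3).ne_zero
              (UnitaryGroup.isUnit_antidiagOne_det L 3).ne_zero hc h₁) (t γ₁) = t γ₂) →
        ArchCompatibleFamiliesH L νH mH tH t →
        IsArchNondegenerate L (phi3 L) (archDeltaPP L μ) →
        IsArchDeltaTransferExists L (phi3 L) (archDeltaPP L μ) mH mG (ArchSmooth L 3 (phi3 L)) (ArchSmooth₂ L) →
        ∀ [∀ w : {w : InfinitePlace L // w.IsComplex}, MeasurableSpace ↥(archLocal L 3 (phi3 L) w)]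
          [∀ w : {w : InfinitePlace L // w.IsComplex}, BorelSpace ↥(archLocal L 3 (phi3 L) w)]
          (νw : ∀ w : {w : InfinitePlace L // w.IsComplex}, Measure ↥(archLocal L 3 (phi3 L) w))
          [∀ w, (νw w).IsHaarMeasure] [∀ w, (νw w).IsMulRightInvariant],
        letI : ∀ (w : {w : InfinitePlace L // w.IsComplex}) (δ : ↥(archLocal L 3 (phi3 L) w)),
            MeasurableSpace (↥(archLocal L 3 (phi3 L) w) ⧸ Subgroup.centralizer ({δ} : Set ↥(archLocal L 3 (phi3 L) w))) := fun _ _ => borel _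
        haveI : ∀ (w : {w : InfinitePlace L // w.IsComplex}) (δ : ↥(archLocal L 3 (phi3 L) w)),
            BorelSpace (↥(archLocal L 3 (phi3 L) w) ⧸ Subgroup.centralizer ({δ} : Set ↥(archLocal L 3 (phi3 L) w))) := fun _ _ => ⟨rfl⟩
        ν.map ⇑(archPiEquivCM L (phi3 L) (N := 3)) = Measure.pi νw →
          ∃ d : ∀ w : {w : InfinitePlace L // w.IsComplex}, BlockPacketData (Fin 3) ↥(archLocal L 3 (phi3 L) w) (νw w) (S w),
            (∀ (EG : ({w : InfinitePlace L // w.IsComplex} → Fin 3) → Type)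
                [∀ k, NormedAddCommGroup (EG k)] [∀ k, InnerProductSpace ℂ (EG k)] [∀ k, CompleteSpace (EG k)]
                (ϖ : ∀ k, ContRepresentation ℂ (GInf L) (EG k)) (hu : ∀ k, (ϖ k).IsUnitary) (hsc : ∀ k, (ϖ k).IsStronglyContinuous),
                (∀ k, letI := fun w => (d w).instNACG (k w); letI := fun w => (d w).instIPS (k w); letI := fun w => (d w).instCS (k w)
                  HasLocalComponents (archPiEquivCM L (phi3 L) (N := 3)) ν νw (ϖ k) (hu k) (hsc k)
                    (fun w => (d w).E (k w)) (fun w => (d w).π (k w)) (fun w => (d w).hu (k w)) (fun w => (d w).hsc (k w))) →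
                ∃ (EH : Type) (_ : NormedAddCommGroup EH) (_ : InnerProductSpace ℂ EH) (_ : CompleteSpace EH)
                  (ρ : ContRepresentation ℂ (HInf L) EH) (huH : ρ.IsUnitary) (hscH : ρ.IsStronglyContinuous),
                  IsArchEndoCharId L (archDeltaPP L μ) mH mG ν νH EG ϖ hu hsc (fun k => ∏ w, (d w).sgn (k w)) ρ huH hscH) ∧
            (∀ u : {w : InfinitePlace L // w.IsComplex},
              IsArchLocStablyNull L u (νw u) ⇑((d u).φ (d u).bpos - (d u).φ (d u).bneg) ∧
                ∃ fH : C_c(HInf L, ℂ), ArchSmooth₂ L ⇑fH ∧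
                  IsArchDeltaTransfer L (phi3 L) (archDeltaPP L μ) mH mG ⇑fH
                    ⇑(archTensor L (phi3 L) (Function.update (fun w => (d w).φ (d w).bpos) u ((d u).φ (d u).bpos - (d u).φ (d u).bneg))) ∧
                  ∀ ι : L →+* ℂ, CuspH₀ L mH ι ⇑fH) :=
  Iff.rfl

end Letter

end Summit.HodgeConjecture.HodgeConjecture.R90.S2

end
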